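import Literature.Probability.RandomPlanarGeometry.SLEScaleInvariance
import Literature.Probability.RandomPlanarGeometry.SLEExistenceConverse
import Literature.Probability.RandomPlanarGeometry.CaratheodoryHalfPlaneProofs
import Literature.Probability.RandomPlanarGeometry.SLEConvergenceCriterion
import HarnessLib

/-!
# Uniqueness in law of chordal SLE_κ in a Dobrushin domain (`IsSLECurve.map_eq`), discharged

Trunk T-STOCH / topic `Literature/Probability/RandomPlanarGeometry`. The named fact
`Literature.Probability.RandomPlanarGeometry.IsSLECurve.map_eq` (`SLE.lean`; Lawler (2005), §6.1;
Rohde–Schramm (2005), Prop. 2.1 (i)) says that two chordal SLE_κ random curves `Γ, Γ'` in the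
same Dobrushin domain `(D; a, b)` — built from possibly different chordal uniformizing maps
`φ, φ' : ℍₒ → D` — have the same law on `CurveClass ℂ`. It is the uniqueness half of "chordal
SLE_κ in `(D; a, b)` is a well-defined law" (`existsUnique_isSLELaw`) and the hypothesis `huniq`
of every "tightness + identification ⇒ convergence to SLE" assembly of the lattice-model files
(`LatticeModels/InterfaceSLEProofs`, `InterfaceSLETightness`, `FKIsingInterfaceSLE`, …,
`SLEConvergenceCriterion`).

`SLEProofs.lean` reduced the fact to three inputs (`IsSLECurve.map_eq_of_facts`): uniqueness of
chordal uniformizing maps up to a dilation (`h₁`), SLE scaling in law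
(`h₅ : identDistrib_sleTrace_scale`, for *every* `κ`) and Carathéodory continuity of the boundary
extension (`h₇`); `h₁` and `h₇` are by now theorems of the tree (Carathéodory's theorem,
`JordanDomain.exists_continuousOn_extension_holds` / `JordanDomain.continuousOn_boundaryExtension_holds`,
and `MarkedDomain.IsChordalUniformizing.exists_eq_trans_smul_of_disc`), while `h₅` was reduced to
the two SLE trace theorems (`identDistrib_sleTrace_scale_of_trace_theorems`,
`SLEScaleInvariance.lean`), which remain named facts.

**This file proves `IsSLECurve.map_eq` outright** (`IsSLECurve.map_eq_holds`). The observation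
is that the printed proof only uses SLE scaling *at the given `κ`*, and that scaling at `κ` is a
theorem as soon as SLE_κ is a.s. generated by a curve (`identDistrib_sleTrace_scale_of_hasSLETrace`,
`SLEScaleInvariance.lean`) — which the hypothesis `IsSLECurve κ D Γ` itself asserts
(its almost-sure clause contains `Loewner.IsGeneratedByCurve (sleDriving κ ω) (sleTrace κ ω)`;
`IsSLECurve.hasSLETrace`, `SLEExistenceConverse.lean`). So no trace theorem is needed: for a `κ`
without a trace there is no SLE_κ random curve and the statement is empty, for a `κ` with a trace
every input is proved. The proof of `IsSLECurve.map_eq_of_hasSLETrace` below is the proof of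
`IsSLECurve.map_eq_of_facts` verbatim with `h₅ κ` replaced by the per-`κ` scaling.

Consequences recorded for the dependents: `IsSLELaw.unique'` (two SLE_κ laws in the same
Dobrushin domain coincide, unconditionally), `existsUnique_isSLELaw_of_exists` (well-definedness
of the SLE_κ law from existence alone), `IsSLELaw.eq_map_of_isSLECurve`, and the convergence
criterion of `SLEConvergenceCriterion.lean` (tightness + identification of subsequential limits
⟹ convergence in law to SLE_κ) with its uniqueness hypothesis `huniq` discharged:
`convergesInLawToSLE_of_isTightAlongMesh'`, `convergesInLawToSLE_of_isTightMeasureSet_image'`,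
`convergesInLawToSLE_of_isTightLaws'`.

## Mathlib

USED: `ProbabilityTheory.IdentDistrib` (`map_eq`, `aemeasurable_fst/snd`),
`AEMeasurable.map_map_of_aemeasurable`, `Measure.map_congr`, `Real.toNNReal`,
`IsTightMeasureSet`. Everything SLE-specific comes from the tree (`SLE.lean`, `SLEProofs.lean`,
`SLEScaleInvariance.lean`, `SLEExistenceConverse.lean`, `HalfPlaneAutomorphism.lean`, the
Carathéodory files, `SLEConvergenceCriterion.lean`).

## References

* G. F. Lawler, *Conformally Invariant Processes in the Plane*, AMS (2005), §6.1 (paragraph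
  after Remark 6.7: "the definition is independent of the choice of map up to a time change")
  and Prop. 6.5 (SLE scaling).
* S. Rohde, O. Schramm, *Basic properties of SLE*, Ann. of Math. 161 (2005), Prop. 2.1 (i).
* Ch. Pommerenke, *Boundary Behaviour of Conformal Maps*, Springer (1992), Thms 2.1, 2.6.
-/

noncomputable section

open Set Filter Topology MeasureTheory ProbabilityTheory
open UpperHalfPlane (upperHalfPlaneSet isOpen_upperHalfPlaneSet)
open scoped NNReal unitInterval

namespace Literature.Probability.RandomPlanarGeometry

variable {κ : ℝ≥0} {D : DobrushinDomain} {Γ Γ' : (ℝ≥0 → ℝ) → CurveClass ℂ}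

/-- **Independence of the uniformizing map, per `κ`, from uniqueness of uniformizing maps up to
dilation (`h₁`) and Carathéodory continuity of boundary extensions (`h₇`) alone.** Two chordal
SLE_κ random curves in the same Dobrushin domain have the same law. Proof: as in
`IsSLECurve.map_eq_of_facts` — with `φ' = φ ∘ (r • ·)`, a.s. `Γ = Ψ(γ)` and
`Γ' = Ψ(t ↦ r γ(t / r²))` for the measurable functional `Ψ = compactifiedClass Φ b` (`Φ` the
truncated boundary extension of `φ`, `b = D.pt 1`), and the identity in law of `γ` and
`t ↦ r γ(t / r²)` is pushed through `Ψ` — except that SLE scaling is invoked at this `κ` only,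
where it is a theorem (`identDistrib_sleTrace_scale_of_hasSLETrace`) because `IsSLECurve κ D Γ`
gives `HasSLETrace κ` (`IsSLECurve.hasSLETrace`). Lawler (2005), §6.1 and Prop. 6.5.
[cite: Lawler2005, §6.1] -/
theorem IsSLECurve.map_eq_of_hasSLETrace_scaling
    (h₁ : MarkedDomain.IsChordalUniformizing.exists_eq_trans_smul)
    (h₇ : JordanDomain.continuousOn_boundaryExtension)
    (hΓ : IsSLECurve κ D Γ) (hΓ' : IsSLECurve κ D Γ') :
    Process.preWienerMeasure.map Γ = Process.preWienerMeasure.map Γ' := by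
  have hκ : HasSLETrace κ := hΓ.hasSLETrace
  obtain ⟨-, φ, hφ, hae⟩ := hΓ
  obtain ⟨-, φ', hφ', hae'⟩ := hΓ'
  obtain ⟨r, hr, hEq⟩ := h₁ hφ hφ'
  have hΦm : Measurable φ.truncatedBoundaryExtension :=
    ConformalEquiv.measurable_truncatedBoundaryExtension h₇ D.toJordanDomain φ
  have hΨ : Measurable (compactifiedClass φ.truncatedBoundaryExtension (D.pt 1)) :=
    measurable_compactifiedClass hΦm _
  -- the dilation factor as an element of `ℝ≥0`
  obtain ⟨rn, hrn0, hrn⟩ : ∃ rn : ℝ≥0, rn ≠ 0 ∧ (rn : ℝ) = r :=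
    ⟨r.toNNReal, (Real.toNNReal_pos.2 hr).ne', Real.coe_toNNReal r hr.le⟩
  -- SLE scaling at this `κ`: a theorem, since SLE_κ has a trace
  have hID := identDistrib_sleTrace_scale_of_hasSLETrace hκ hrn0
  -- a.s. `Γ = Ψ ∘ trace`
  have hΓ₁ : Γ =ᵐ[Process.preWienerMeasure]
      compactifiedClass φ.truncatedBoundaryExtension (D.pt 1) ∘ fun ω ↦ sleTrace κ ω := by
    filter_upwards [hae] with ω ⟨hgen, c, hΓc, hc⟩
    rw [Function.comp_apply, hΓc]
    exact (IsCompactifiedImage.compactifiedClass_eq (hc.congr_left fun t ↦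
      φ.truncatedBoundaryExtension_eq (hgen.im_nonneg t))).symm
  -- a.s. `Γ' = Ψ ∘ (rescaled trace)`
  have hΓ₂ : Γ' =ᵐ[Process.preWienerMeasure]
      compactifiedClass φ.truncatedBoundaryExtension (D.pt 1) ∘
        fun ω t ↦ (rn : ℂ) * sleTrace κ ω (t / rn ^ 2) := by
    filter_upwards [hae'] with ω ⟨hgen, c, hΓc, hc⟩
    rw [Function.comp_apply, hΓc]
    -- `c` is the compactified `Φ`-image of the dilated trace `r γ`
    have hc' : IsCompactifiedImage φ.truncatedBoundaryExtension
        (fun t ↦ (rn : ℂ) * sleTrace κ ω (rn ^ 2 * t / rn ^ 2)) (D.pt 1) c := by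
      refine ⟨fun s hs ↦ ?_, hc.2⟩
      have him : 0 ≤ ((rn : ℂ) * sleTrace κ ω (rayParam s)).im := by
        rw [Complex.im_ofReal_mul]
        exact mul_nonneg rn.2 (hgen.im_nonneg _)
      rw [hc.1 s hs, φ.boundaryExtension_eq_of_eqOn_smul_trans φ' hr hEq]
      beta_reduce
      rw [mul_div_cancel_left₀ _ (pow_ne_zero 2 hrn0), φ.truncatedBoundaryExtension_eq him,
        Complex.real_smul, ← hrn]
    have key := IsCompactifiedImage.of_comp_mul
      (γ := fun t ↦ (rn : ℂ) * sleTrace κ ω (t / rn ^ 2)) (pow_ne_zero 2 hrn0) hc'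
    rw [key.compactifiedClass_eq, CurveClass.mk_reparam]
  -- push the identity in law through the measurable functional
  calc Process.preWienerMeasure.map Γ
      = Process.preWienerMeasure.map
          (compactifiedClass φ.truncatedBoundaryExtension (D.pt 1) ∘ fun ω ↦ sleTrace κ ω) :=
        Measure.map_congr hΓ₁
    _ = (Process.preWienerMeasure.map fun ω ↦ sleTrace κ ω).map
          (compactifiedClass φ.truncatedBoundaryExtension (D.pt 1)) :=
        (AEMeasurable.map_map_of_aemeasurable hΨ.aemeasurable hID.aemeasurable_fst).symm
    _ = (Process.preWienerMeasure.map fun ω t ↦ (rn : ℂ) * sleTrace κ ω (t / rn ^ 2)).map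
          (compactifiedClass φ.truncatedBoundaryExtension (D.pt 1)) := by
        rw [hID.map_eq]
    _ = Process.preWienerMeasure.map
          (compactifiedClass φ.truncatedBoundaryExtension (D.pt 1) ∘
            fun ω t ↦ (rn : ℂ) * sleTrace κ ω (t / rn ^ 2)) :=
        AEMeasurable.map_map_of_aemeasurable hΨ.aemeasurable hID.aemeasurable_snd
    _ = Process.preWienerMeasure.map Γ' := (Measure.map_congr hΓ₂).symm

/-- **`IsSLECurve.map_eq` holds (discharge of the named fact of `SLE.lean`).** Two chordal SLE_κ
random curves in the same Dobrushin domain `(D; a, b)` have the same law on `CurveClass ℂ`, for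
every `κ : ℝ≥0` and every `D`, unconditionally: uniqueness of chordal uniformizing maps up to
dilation and continuity of boundary extensions come from Carathéodory's theorem, proved in the
tree (`JordanDomain.exists_continuousOn_extension_holds`, Pommerenke (1992), Thm. 2.6;
`JordanDomain.continuousOn_boundaryExtension_holds`, Thm. 2.1), and SLE scaling is only needed at
the given `κ`, where the hypothesis supplies the trace (`IsSLECurve.map_eq_of_hasSLETrace_scaling`).
Lawler (2005), §6.1 ("the definition is independent of the choice of map up to a time change");
Rohde–Schramm (2005), Prop. 2.1 (i). [cite: Lawler2005, §6.1] -/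
theorem IsSLECurve.map_eq_holds : IsSLECurve.map_eq :=
  fun hΓ hΓ' ↦ IsSLECurve.map_eq_of_hasSLETrace_scaling
    (MarkedDomain.IsChordalUniformizing.exists_eq_trans_smul_of_disc
      JordanDomain.exists_continuousOn_extension_holds)
    JordanDomain.continuousOn_boundaryExtension_holds hΓ hΓ'

/-- Two chordal SLE_κ laws in the same Dobrushin domain coincide — the unconditional form of
`IsSLELaw.unique` (`SLE.lean`), its hypothesis `huniq` being discharged by
`IsSLECurve.map_eq_holds`. Lawler (2005), §6.1 and §6.3. [cite: Lawler2005, §6.1] -/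
theorem IsSLELaw.unique' {μ μ' : Measure (CurveClass ℂ)} (h : IsSLELaw κ D μ)
    (h' : IsSLELaw κ D μ') : μ = μ' :=
  IsSLELaw.unique IsSLECurve.map_eq_holds h h'

/-- The law of any chordal SLE_κ random curve in `(D; a, b)` is *the* SLE_κ law: if `μ` is an
SLE_κ law in `D` and `Γ` an SLE_κ random curve in `D`, then `μ` is the law of `Γ`.
Lawler (2005), §6.3. [cite: Lawler2005, §6.3] -/
theorem IsSLELaw.eq_map_of_isSLECurve {μ : Measure (CurveClass ℂ)} (h : IsSLELaw κ D μ)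
    (hΓ : IsSLECurve κ D Γ) : μ = Process.preWienerMeasure.map Γ :=
  h.unique' hΓ.isSLELaw_map

/-- **Chordal SLE_κ in `(D; a, b)` is a well-defined law, from existence alone**: given the
existence fact `exists_isSLECurve` (hypothesis `hex`; equivalent to the SLE trace theorems,
`exists_isSLECurve_iff`) there is exactly one SLE_κ law in every Dobrushin domain for `κ > 0`
— `existsUnique_isSLELaw` with its uniqueness hypothesis discharged. Schramm (2000), §1;
Lawler (2005), §6.3. [cite: Lawler2005, §6.3] -/
theorem existsUnique_isSLELaw_of_exists (hex : exists_isSLECurve) (hκ : 0 < κ)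
    (D : DobrushinDomain) : ∃! μ, IsSLELaw κ D μ :=
  existsUnique_isSLELaw hex IsSLECurve.map_eq_holds hκ D

/-- For a fixed `κ` and Dobrushin domain, one SLE_κ random curve `Γ` already makes the SLE_κ law
in `D` unique: every SLE_κ law in `D` is `preWienerMeasure.map Γ`. (Pointwise form of
`existsUnique_isSLELaw_of_exists`, needing no existence fact.) Lawler (2005), §6.3.
[cite: Lawler2005, §6.3] -/
theorem IsSLECurve.existsUnique_isSLELaw (hΓ : IsSLECurve κ D Γ) : ∃! μ, IsSLELaw κ D μ :=
  ⟨_, hΓ.isSLELaw_map, fun _ h ↦ h.eq_map_of_isSLECurve hΓ⟩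

/-! ### The convergence criterion with uniqueness of the SLE law discharged -/

section Criterion

variable {Ωδ : ℝ → Type*} [∀ δ, MeasurableSpace (Ωδ δ)] {Y : ∀ δ, Ωδ δ → CurveClass ℂ}
  {P : ∀ δ, Measure (Ωδ δ)}

/-- **Convergence to SLE_κ from tightness and identification of subsequential limits**
(`convergesInLawToSLE_of_isTightAlongMesh` with `huniq` discharged by `IsSLECurve.map_eq_holds`):
a.e.-measurable random curve classes `Y δ` under probability laws `P δ`, tight as `δ → 0⁺`
(`IsTightAlongMesh`), all of whose subsequential limit laws are chordal SLE_κ laws in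
`(D; a, b)`, converge in law to chordal SLE_κ. Billingsley (1999), Corollary to Thm. 5.1;
Duminil-Copin–Smirnov (2012), proof of Thm. 3.13; CDHKS (2014), §3.
[cite: BillingsleyCPM1999, Thm. 5.1, Corollary] -/
theorem convergesInLawToSLE_of_isTightAlongMesh' [∀ δ, IsProbabilityMeasure (P δ)]
    (hY : ∀ᶠ δ in 𝓝[>] (0 : ℝ), AEMeasurable (Y δ) (P δ)) (hT : IsTightAlongMesh Y P)
    (hL : ∀ μ : Measure (CurveClass ℂ), IsProbabilityMeasure μ → IsSubseqLimitLaw Y P μ →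
      IsSLELaw κ D μ) :
    ConvergesInLawToSLE κ D Y P :=
  convergesInLawToSLE_of_isTightAlongMesh IsSLECurve.map_eq_holds hY hT hL

/-- The criterion with set-level tightness on an initial mesh interval
(`convergesInLawToSLE_of_isTightMeasureSet_image` with `huniq` discharged).
[cite: BillingsleyCPM1999, Thm. 5.1, Corollary] -/
theorem convergesInLawToSLE_of_isTightMeasureSet_image' [∀ δ, IsProbabilityMeasure (P δ)]
    (hY : ∀ᶠ δ in 𝓝[>] (0 : ℝ), AEMeasurable (Y δ) (P δ)) {δ₀ : ℝ} (hδ₀ : 0 < δ₀)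
    (hT : IsTightMeasureSet ((fun δ ↦ (P δ).map (Y δ)) '' Set.Ioc 0 δ₀))
    (hL : ∀ μ : Measure (CurveClass ℂ), IsProbabilityMeasure μ → IsSubseqLimitLaw Y P μ →
      IsSLELaw κ D μ) :
    ConvergesInLawToSLE κ D Y P :=
  convergesInLawToSLE_of_isTightMeasureSet_image IsSLECurve.map_eq_holds hY hδ₀ hT hL

/-- The criterion with the whole-family tightness hypothesis `IsTightLaws`
(`convergesInLawToSLE_of_isTightLaws` with `huniq` discharged).
[cite: BillingsleyCPM1999, Thm. 5.1, Corollary] -/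
theorem convergesInLawToSLE_of_isTightLaws' [∀ δ, IsProbabilityMeasure (P δ)]
    (hY : ∀ᶠ δ in 𝓝[>] (0 : ℝ), AEMeasurable (Y δ) (P δ))
    (hT : IsTightLaws fun δ ↦ (P δ).map (Y δ))
    (hL : ∀ μ : Measure (CurveClass ℂ), IsProbabilityMeasure μ → IsSubseqLimitLaw Y P μ →
      IsSLELaw κ D μ) :
    ConvergesInLawToSLE κ D Y P :=
  convergesInLawToSLE_of_isTightLaws IsSLECurve.map_eq_holds hY hT hL

end Criterion

end Literature.Probability.RandomPlanarGeometry
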